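import Summits.ResolutionOfSingularities.ResolutionOfSingularities.Theorems.HilbertSamuelEliminationSigmaMaxModificationsCorridor3WLadderRecognitionNearLocus
import Literature.AlgebraicGeometry.CossartJannsenSaito2020.BlowupTowerLocalizeTransfer
import Literature.AlgebraicGeometry.Resolution.ResolutionGlue
import Mathlib.AlgebraicGeometry.PullbackCarrier
import HarnessLib

/-!
# [OURS · L1 W4.2] RECOGNITION-GEOMETRY (R2), PART 6: LOCAL → GLOBAL TRANSFER of the shape of the near locus along the
# localisation `T ×_{X_0} Spec 𝒪_{X_0,x}` (and any flat preimmersion base change) (crux chain w42, line `w_ladder`;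
# `--supports stmt-…-19249`, helper)

OURS (cell res-hironaka, slot W4.2, seat res-L1-w42-stub-2 gen 4); NOT statements of H. Hironaka's manuscript [Hironaka2017]
nor of [CossartJannsenSaito2020]. AI-drafted, weaker than expert review. Sorry-free PROOF file (no new definition), FACT-FREE.

PARTS 1–5 produce (Dich) «irreducible or finite» / (RegN) «regular if infinite» for the near loci of an abstract tower; stub-1
instantiates them on the LOCALISED (compressed) unit tower and reads its label calculus on the GLOBAL stages
(`(upTower b).nearLocus 3 x_b n`). CJS p. 107: «the claims … depend only on the localization `X_x = Spec(𝒪_{X,x})`». Over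
res-type-053's base-change kit (`BlowupTower.baseChange`, `bcι`, `nearLocus_baseChange`, `range_bcι`,
`comap_vanishingIdeal_eq_of_flat_of_isPreimmersion`), for a base change along a FLAT PREIMMERSION `ι₀ : S₀ ⟶ X_0` (e.g.
`Spec 𝒪_{X_0,x} ⟶ X_0`, `T.localize x`) and `s₀ ∈ S₀`:

* `image_nearLocus_baseChange` — **`ι_q(N^S_q(s₀)) = N_q(ι₀ s₀)`**: the comparison map is a BIJECTION between the near loci (every
  point of `N_q` lies over `ι₀ s₀`, hence in the range of `ι_q`);
* `finite_nearLocus_baseChange_iff` — `N^S_q` finite iff `N_q` finite; `isIrreducible_nearLocus_of_baseChange` — `N^S_q` irreducible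
  ⇒ `N_q` irreducible; `isRegular_nearLocus_of_baseChange` — the reduced subscheme on `N_q` is regular if the one on `N^S_q` is (the
  local rings agree along the flat preimmersion `V(N_q) ×_X S ⟶ V(N_q)`);
* `image_fibre_baseChange`, `isClosed_image_bcι_of_subset_fibre`, `isClosed_singleton_bcι_of_phi_eq` — for `ι₀ s₀` CLOSED, closed
  subsets / points of the fibre over `s₀` map to closed subsets / points (the embedding `ι_q` restricted to the fibre has closed
  image); `nontrivial_nearLocus_baseChange_iff`, `forall_isClosed_singleton_nearLocus_of_baseChange`,
  `exists_not_isClosed_singleton_nearLocus_of_baseChange`;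
* `localize` specialisations: `image_nearLocus_localize`, `finite_nearLocus_localize_iff`, `isIrreducible_nearLocus_of_localize`,
  `isRegular_nearLocus_of_localize`, and the packaged **`dich_of_localize` / `regN_of_localize` / `dichPlus_of_localize`** in
  stub-1's shapes (the last with the dominant branch as «irreducible ∧ nontrivial ∧ a non-closed point ∧ regular» and the finite
  branch as «finite ∧ all points closed»);
* APPENDED: the standing hypotheses transfer DOWN — `isClosed_hsStratumGE_baseChange` / `isClosed_hsStratumGE_localize` (closed strata
  on the base-changed / localised tower), `isNoetherian_localize_zero` (`Spec 𝒪_{X_0,x}` is noetherian).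

## References

* V. Cossart, U. Jannsen, S. Saito, LNM 2270 (2020): p. 107, Def. 6.34 (ii), Def. 6.38 (iii). [CossartJannsenSaito2020]
* U. Görtz, T. Wedhorn, *Algebraic Geometry I* (2020), Prop. 13.91 (base change). [GortzWedhorn2020]
-/

noncomputable section

-- namespace `…Corridor3.Helpers` re-enters `…Corridor3`
set_option linter.dupNamespace false

open CategoryTheory CategoryTheory.Limits AlgebraicGeometry TopologicalSpace IsLocalRing
open Literature.AlgebraicGeometry.Resolution
open Scheme.IdealSheafData

universe u

open Literature.AlgebraicGeometry.CossartJannsenSaito2020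

namespace Summit.ResolutionOfSingularities.ResolutionOfSingularities.Theorems.SigmaMaxModificationsCorridor3.Helpers

/-! ## §0. Regularity of a reduced closed subscheme transfers UP along a flat preimmersion covering its support -/

/-- **If `V(J) ×_X S` is regular and the support of `J` lies in the range of the flat preimmersion `ι : S ⟶ X`, then `V(J)` is
regular**: every point of `V(J)` is hit by `V(J) ×_X S ⟶ V(J)`, a flat preimmersion, hence with isomorphic local rings (converse
direction of res-type-053's `isRegular_subscheme_comap_of_flat_of_isPreimmersion`). [cite: CossartJannsenSaito2020, p. 107] -/
theorem isRegular_subscheme_of_comap_of_support_subset_range {S X : Scheme.{u}} (ι : S ⟶ X) [Flat ι] [IsPreimmersion ι]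
    (J : X.IdealSheafData) (hsupp : (J.support : Set X) ⊆ Set.range ι.base)
    (h : Scheme.IsRegular (J.comap ι).subscheme) : Scheme.IsRegular J.subscheme := by
  -- the fibre product `P = S ×_X V(J)` is regular (isomorphic to `V(J·𝒪_S)`)
  have hP : Scheme.IsRegular (pullback ι J.subschemeι) := Scheme.IsRegular.of_iso (J.comapIso ι).hom h
  intro p
  -- `p` is hit by `pr₂ : P ⟶ V(J)`
  have hp : J.subschemeι.base p ∈ Set.range ι.base := by
    apply hsupp
    have : J.subschemeι.base p ∈ Set.range J.subschemeι.base := ⟨p, rfl⟩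
    rw [J.range_subschemeι] at this
    exact this
  have hp' : p ∈ Set.range (pullback.snd ι J.subschemeι).base := by
    rw [Scheme.Pullback.range_snd]; exact hp
  obtain ⟨p', rfl⟩ := hp'
  haveI := isIso_stalkMap_of_flat_of_isPreimmersion (pullback.snd ι J.subschemeι) p'
  haveI := hP p'
  exact IsRegularLocalRing.of_ringEquiv (asIso ((pullback.snd ι J.subschemeι).stalkMap p')).commRingCatIsoToRingEquiv.symm

namespace BlowupTowerNear

/-! ## §1. Base change along a flat preimmersion: the near loci correspond bijectively -/

section BaseChange

variable (T : BlowupTower.{u}) {S₀ : Scheme.{u}} (ι₀ : S₀ ⟶ T.X 0) [Flat ι₀] [IsPreimmersion ι₀] [IsLocallyNoetherian S₀]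
  (N : ℕ) (s₀ : S₀) (q : ℕ)

omit [Flat ι₀] [IsPreimmersion ι₀] [IsLocallyNoetherian S₀] in
/-- Every point of `N_q(ι₀ s₀)` is in the range of the comparison map `ι_q` (it lies over `ι₀ s₀`). [cite: CossartJannsenSaito2020, p. 107] -/
theorem nearLocus_subset_range_bcι : T.nearLocus N (ι₀.base s₀) q ⊆ Set.range (T.bcι ι₀ q).base := by
  intro z hz
  rw [T.range_bcι ι₀ q, Set.mem_preimage, hz.1]
  exact ⟨s₀, rfl⟩

/-- **`ι_q(N^S_q(s₀)) = N_q(ι₀ s₀)`**: the comparison map is a bijection between the near loci of the base-changed tower and of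
`T`. [cite: CossartJannsenSaito2020, Def. 6.34 (ii), p. 107] -/
theorem image_nearLocus_baseChange :
    (T.bcι ι₀ q).base '' (T.baseChange ι₀).nearLocus N s₀ q = T.nearLocus N (ι₀.base s₀) q := by
  rw [T.nearLocus_baseChange ι₀ N s₀ q, Set.image_preimage_eq_inter_range,
    Set.inter_eq_left.mpr (nearLocus_subset_range_bcι T ι₀ N s₀ q)]

/-- `ι_q` is a bijection `N^S_q(s₀) → N_q(ι₀ s₀)`. [cite: CossartJannsenSaito2020, p. 107] -/
theorem bijOn_nearLocus_baseChange :
    Set.BijOn (T.bcι ι₀ q).base ((T.baseChange ι₀).nearLocus N s₀ q) (T.nearLocus N (ι₀.base s₀) q) := by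
  refine Set.BijOn.mk ?_ ((T.bcι_injective ι₀ q).injOn) ?_
  · intro s hs
    rw [T.nearLocus_baseChange ι₀ N s₀ q] at hs
    exact hs
  · rw [Set.SurjOn, image_nearLocus_baseChange]

/-- **`N^S_q` is finite iff `N_q` is.** [cite: CossartJannsenSaito2020, p. 107] -/
theorem finite_nearLocus_baseChange_iff :
    ((T.baseChange ι₀).nearLocus N s₀ q).Finite ↔ (T.nearLocus N (ι₀.base s₀) q).Finite := by
  constructor
  · intro h; rw [← image_nearLocus_baseChange]; exact h.image _
  · intro h
    rw [T.nearLocus_baseChange ι₀ N s₀ q]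
    exact h.preimage (T.bcι_injective ι₀ q).injOn

/-- **`N^S_q` irreducible ⇒ `N_q` irreducible** (a continuous image). [cite: CossartJannsenSaito2020, p. 107] -/
theorem isIrreducible_nearLocus_of_baseChange (h : IsIrreducible ((T.baseChange ι₀).nearLocus N s₀ q)) :
    IsIrreducible (T.nearLocus N (ι₀.base s₀) q) := by
  rw [← image_nearLocus_baseChange]
  exact h.image _ (T.bcι ι₀ q).continuous.continuousOn

/-- **The reduced subscheme on `N_q` is regular if the one on `N^S_q` is** (the local rings agree along the flat preimmersion).
[cite: CossartJannsenSaito2020, p. 107, Def. 3.1] -/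
theorem isRegular_nearLocus_of_baseChange (hS : IsClosed ((T.baseChange ι₀).nearLocus N s₀ q))
    (hN : IsClosed (T.nearLocus N (ι₀.base s₀) q))
    (h : Scheme.IsRegular (vanishingIdeal (⟨(T.baseChange ι₀).nearLocus N s₀ q, hS⟩ : Closeds (T.bcX ι₀ q))).subscheme) :
    Scheme.IsRegular (vanishingIdeal (⟨T.nearLocus N (ι₀.base s₀) q, hN⟩ : Closeds (T.X q))).subscheme := by
  haveI := T.flat_bcι ι₀ q
  haveI := T.isPreimmersion_bcι ι₀ q
  set J : (T.X q).IdealSheafData := vanishingIdeal (⟨T.nearLocus N (ι₀.base s₀) q, hN⟩ : Closeds (T.X q)) with hJ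
  have hcomap : J.comap (T.bcι ι₀ q) = vanishingIdeal (⟨(T.baseChange ι₀).nearLocus N s₀ q, hS⟩ : Closeds (T.bcX ι₀ q)) := by
    rw [hJ, comap_vanishingIdeal_eq_of_flat_of_isPreimmersion]
    congr 1
    refine Closeds.ext ?_
    simp only [TopologicalSpace.Closeds.coe_preimage, TopologicalSpace.Closeds.coe_mk]
    exact (T.nearLocus_baseChange ι₀ N s₀ q).symm
  refine isRegular_subscheme_of_comap_of_support_subset_range (T.bcι ι₀ q) J ?_ (hcomap ▸ h)
  rw [hJ, Scheme.IdealSheafData.coe_support_vanishingIdeal]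
  exact nearLocus_subset_range_bcι T ι₀ N s₀ q

/-- The points of `S_q` over `s₀` map ONTO the points of `X_q` over `ι₀ s₀` (`ι₀` injective, `ι_q φ_q`-compatible).
[cite: CossartJannsenSaito2020, p. 107] -/
theorem image_fibre_baseChange :
    (T.bcι ι₀ q).base '' {s | ((T.baseChange ι₀).phi q).base s = s₀} = (T.phi q).base ⁻¹' {ι₀.base s₀} := by
  apply subset_antisymm
  · rintro _ ⟨s, hs, rfl⟩
    rw [Set.mem_setOf_eq] at hs
    rw [Set.mem_preimage, Set.mem_singleton_iff, T.phi_bcι_apply ι₀ q s, hs]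
  · intro z hz
    have hzr : z ∈ Set.range (T.bcι ι₀ q).base := by
      rw [T.range_bcι ι₀ q, Set.mem_preimage, Set.mem_singleton_iff.mp hz]; exact ⟨s₀, rfl⟩
    obtain ⟨s, rfl⟩ := hzr
    refine ⟨s, ?_, rfl⟩
    rw [Set.mem_setOf_eq]
    apply ι₀.isEmbedding.injective
    rw [← T.phi_bcι_apply ι₀ q s]
    exact Set.mem_singleton_iff.mp hz

/-- **Closed subsets of the fibre transfer UP**: for `ι₀ s₀` CLOSED, a closed `A ⊆ φ'_q⁻¹(s₀)` has closed image `ι_q(A) ⊆ X_q` (the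
comparison map is a topological embedding whose restriction to the fibre has the closed image `φ_q⁻¹(ι₀ s₀)`).
[cite: CossartJannsenSaito2020, p. 107] -/
theorem isClosed_image_bcι_of_subset_fibre (hx : IsClosed ({ι₀.base s₀} : Set (T.X 0))) {A : Set (T.bcX ι₀ q)}
    (hA : A ⊆ {s | ((T.baseChange ι₀).phi q).base s = s₀}) (hAcl : IsClosed A) : IsClosed ((T.bcι ι₀ q).base '' A) := by
  haveI := T.isPreimmersion_bcι ι₀ q
  obtain ⟨K, hK, hKA⟩ := (T.bcι ι₀ q).isEmbedding.isInducing.image_eq_isClosed_inter_range hAcl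
  have hF : IsClosed ((T.phi q).base ⁻¹' {ι₀.base s₀}) := hx.preimage (T.phi q).continuous
  have hsub : (T.bcι ι₀ q).base '' A ⊆ (T.phi q).base ⁻¹' {ι₀.base s₀} := by
    rw [← image_fibre_baseChange]; exact Set.image_mono hA
  have heq : (T.bcι ι₀ q).base '' A = K ∩ (T.phi q).base ⁻¹' {ι₀.base s₀} := by
    apply subset_antisymm
    · exact fun z hz => ⟨(hKA ▸ hz : z ∈ K ∩ _).1, hsub hz⟩
    · rintro z ⟨hzK, hzF⟩
      have hzr : z ∈ Set.range (T.bcι ι₀ q).base := by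
        rw [T.range_bcι ι₀ q, Set.mem_preimage, Set.mem_singleton_iff.mp hzF]; exact ⟨s₀, rfl⟩
      change z ∈ (T.bcι ι₀ q).base '' A
      rw [hKA]; exact ⟨hzK, hzr⟩
  rw [heq]
  exact hK.inter hF

/-- **A closed point over `s₀` maps to a closed point** (for `ι₀ s₀` closed). [cite: CossartJannsenSaito2020, p. 107] -/
theorem isClosed_singleton_bcι_of_phi_eq (hx : IsClosed ({ι₀.base s₀} : Set (T.X 0))) {s : T.bcX ι₀ q}
    (hs : ((T.baseChange ι₀).phi q).base s = s₀) (hscl : IsClosed ({s} : Set (T.bcX ι₀ q))) :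
    IsClosed ({(T.bcι ι₀ q).base s} : Set (T.X q)) := by
  rw [← Set.image_singleton]
  exact isClosed_image_bcι_of_subset_fibre T ι₀ s₀ q hx (by intro t ht; rw [Set.mem_singleton_iff.mp ht]; exact hs) hscl

/-- **`N^S_q` nontrivial iff `N_q` nontrivial** (bijection). [cite: CossartJannsenSaito2020, p. 107] -/
theorem nontrivial_nearLocus_baseChange_iff :
    ((T.baseChange ι₀).nearLocus N s₀ q).Nontrivial ↔ (T.nearLocus N (ι₀.base s₀) q).Nontrivial := by
  have hbij := bijOn_nearLocus_baseChange T ι₀ N s₀ q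
  constructor
  · rintro ⟨a, ha, b, hb, hab⟩
    exact ⟨_, hbij.mapsTo ha, _, hbij.mapsTo hb, fun h => hab (hbij.injOn ha hb h)⟩
  · rintro ⟨a, ha, b, hb, hab⟩
    obtain ⟨a', ha', rfl⟩ := hbij.surjOn ha
    obtain ⟨b', hb', rfl⟩ := hbij.surjOn hb
    exact ⟨a', ha', b', hb', fun h => hab (h ▸ rfl)⟩

/-- **Closed points of `N^S_q` are closed points of `N_q`** (`ι₀ s₀` closed): «all points closed» transfers UP.
[cite: CossartJannsenSaito2020, p. 107] -/
theorem forall_isClosed_singleton_nearLocus_of_baseChange (hx : IsClosed ({ι₀.base s₀} : Set (T.X 0)))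
    (h : ∀ s ∈ (T.baseChange ι₀).nearLocus N s₀ q, IsClosed ({s} : Set (T.bcX ι₀ q))) :
    ∀ z ∈ T.nearLocus N (ι₀.base s₀) q, IsClosed ({z} : Set (T.X q)) := by
  intro z hz
  obtain ⟨s, hs, rfl⟩ := (bijOn_nearLocus_baseChange T ι₀ N s₀ q).surjOn hz
  exact isClosed_singleton_bcι_of_phi_eq T ι₀ s₀ q hx hs.1 (h s hs)

/-- **A non-closed point of `N^S_q` gives a non-closed point of `N_q`** (closedness of points transfers DOWN along `ι_q`,
res-type-053's `isClosed_singleton_of_bcι`). [cite: CossartJannsenSaito2020, p. 107] -/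
theorem exists_not_isClosed_singleton_nearLocus_of_baseChange
    (h : ∃ s ∈ (T.baseChange ι₀).nearLocus N s₀ q, ¬ IsClosed ({s} : Set (T.bcX ι₀ q))) :
    ∃ z ∈ T.nearLocus N (ι₀.base s₀) q, ¬ IsClosed ({z} : Set (T.X q)) := by
  obtain ⟨s, hs, hscl⟩ := h
  exact ⟨_, (bijOn_nearLocus_baseChange T ι₀ N s₀ q).mapsTo hs, fun hz => hscl (T.isClosed_singleton_of_bcι ι₀ q s hz)⟩

end BaseChange

/-! ## §2. The localisation `T.localize x = T ×_{X_0} Spec 𝒪_{X_0,x}` -/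

section Localize

variable (T : BlowupTower.{u}) (N : ℕ) (x : T.X 0) (q : ℕ)

/-- **`ι_q` maps the near locus of the closed point of the localised tower ONTO `N_q(x)`.** [cite: CossartJannsenSaito2020, p. 107] -/
theorem image_nearLocus_localize :
    haveI : IsLocallyNoetherian (T.X 0) := T.ln 0
    haveI := flat_fromSpecStalk (T.X 0) x
    (T.bcι ((T.X 0).fromSpecStalk x) q).base '' (T.localize x).nearLocus N (closedPoint ((T.X 0).presheaf.stalk x)) q =
      T.nearLocus N x q := by
  haveI : IsLocallyNoetherian (T.X 0) := T.ln 0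
  haveI := flat_fromSpecStalk (T.X 0) x
  have h := image_nearLocus_baseChange T ((T.X 0).fromSpecStalk x) N (closedPoint ((T.X 0).presheaf.stalk x)) q
  rwa [Scheme.fromSpecStalk_closedPoint] at h

/-- **The near locus of the localised tower is finite iff `N_q(x)` is.** [cite: CossartJannsenSaito2020, p. 107] -/
theorem finite_nearLocus_localize_iff :
    haveI : IsLocallyNoetherian (T.X 0) := T.ln 0
    haveI := flat_fromSpecStalk (T.X 0) x
    ((T.localize x).nearLocus N (closedPoint ((T.X 0).presheaf.stalk x)) q).Finite ↔ (T.nearLocus N x q).Finite := by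
  haveI : IsLocallyNoetherian (T.X 0) := T.ln 0
  haveI := flat_fromSpecStalk (T.X 0) x
  have h := finite_nearLocus_baseChange_iff T ((T.X 0).fromSpecStalk x) N (closedPoint ((T.X 0).presheaf.stalk x)) q
  rwa [Scheme.fromSpecStalk_closedPoint] at h

/-- **The near locus of the localised tower irreducible ⇒ `N_q(x)` irreducible.** [cite: CossartJannsenSaito2020, p. 107] -/
theorem isIrreducible_nearLocus_of_localize
    (h : haveI : IsLocallyNoetherian (T.X 0) := T.ln 0
      haveI := flat_fromSpecStalk (T.X 0) x
      IsIrreducible ((T.localize x).nearLocus N (closedPoint ((T.X 0).presheaf.stalk x)) q)) :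
    IsIrreducible (T.nearLocus N x q) := by
  haveI : IsLocallyNoetherian (T.X 0) := T.ln 0
  haveI := flat_fromSpecStalk (T.X 0) x
  have h' := isIrreducible_nearLocus_of_baseChange T ((T.X 0).fromSpecStalk x) N (closedPoint ((T.X 0).presheaf.stalk x)) q h
  rwa [Scheme.fromSpecStalk_closedPoint] at h'

/-- **(RegN) transfers UP**: if the reduced near locus of the localised tower is regular, so is the reduced `N_q(x)`.
[cite: CossartJannsenSaito2020, p. 107, Def. 3.1] -/
theorem isRegular_nearLocus_of_localize
    (hS : haveI : IsLocallyNoetherian (T.X 0) := T.ln 0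
      haveI := flat_fromSpecStalk (T.X 0) x
      IsClosed ((T.localize x).nearLocus N (closedPoint ((T.X 0).presheaf.stalk x)) q))
    (hN : IsClosed (T.nearLocus N x q))
    (h : haveI : IsLocallyNoetherian (T.X 0) := T.ln 0
      haveI := flat_fromSpecStalk (T.X 0) x
      Scheme.IsRegular (vanishingIdeal (⟨(T.localize x).nearLocus N (closedPoint ((T.X 0).presheaf.stalk x)) q, hS⟩ :
        Closeds ((T.localize x).X q))).subscheme) :
    Scheme.IsRegular (vanishingIdeal (⟨T.nearLocus N x q, hN⟩ : Closeds (T.X q))).subscheme := by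
  haveI : IsLocallyNoetherian (T.X 0) := T.ln 0
  haveI := flat_fromSpecStalk (T.X 0) x
  have hN' : IsClosed (T.nearLocus N (((T.X 0).fromSpecStalk x).base (closedPoint ((T.X 0).presheaf.stalk x))) q) := by
    rw [Scheme.fromSpecStalk_closedPoint]; exact hN
  have h' := isRegular_nearLocus_of_baseChange T ((T.X 0).fromSpecStalk x) N (closedPoint ((T.X 0).presheaf.stalk x)) q hS hN' h
  have heq : (⟨T.nearLocus N (((T.X 0).fromSpecStalk x).base (closedPoint ((T.X 0).presheaf.stalk x))) q, hN'⟩ :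
      Closeds (T.X q)) = ⟨T.nearLocus N x q, hN⟩ :=
    Closeds.ext (by simp only [Scheme.fromSpecStalk_closedPoint])
  rwa [heq] at h'

/-- **(Dich) transfers UP, in stub-1's shape**: «irreducible or finite» for the localised near locus gives it for `N_q(x)`.
[cite: CossartJannsenSaito2020, p. 107] -/
theorem dich_of_localize
    (h : haveI : IsLocallyNoetherian (T.X 0) := T.ln 0
      haveI := flat_fromSpecStalk (T.X 0) x
      IsIrreducible ((T.localize x).nearLocus N (closedPoint ((T.X 0).presheaf.stalk x)) q) ∨
        ((T.localize x).nearLocus N (closedPoint ((T.X 0).presheaf.stalk x)) q).Finite) :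
    IsIrreducible (T.nearLocus N x q) ∨ (T.nearLocus N x q).Finite := by
  rcases h with h | h
  · exact Or.inl (isIrreducible_nearLocus_of_localize T N x q h)
  · exact Or.inr ((finite_nearLocus_localize_iff T N x q).mp h)

/-- **(RegN) transfers UP, in stub-1's shape**: «regular if infinite» for the localised near locus gives it for `N_q(x)`.
[cite: CossartJannsenSaito2020, p. 107] -/
theorem regN_of_localize
    (hS : haveI : IsLocallyNoetherian (T.X 0) := T.ln 0
      haveI := flat_fromSpecStalk (T.X 0) x
      IsClosed ((T.localize x).nearLocus N (closedPoint ((T.X 0).presheaf.stalk x)) q))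
    (h : haveI : IsLocallyNoetherian (T.X 0) := T.ln 0
      haveI := flat_fromSpecStalk (T.X 0) x
      ((T.localize x).nearLocus N (closedPoint ((T.X 0).presheaf.stalk x)) q).Infinite →
        Scheme.IsRegular (vanishingIdeal (⟨(T.localize x).nearLocus N (closedPoint ((T.X 0).presheaf.stalk x)) q, hS⟩ :
          Closeds ((T.localize x).X q))).subscheme)
    (hN : IsClosed (T.nearLocus N x q)) (hinf : (T.nearLocus N x q).Infinite) :
    Scheme.IsRegular (vanishingIdeal (⟨T.nearLocus N x q, hN⟩ : Closeds (T.X q))).subscheme :=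
  isRegular_nearLocus_of_localize T N x q hS hN
    (h (fun hf => hinf ((finite_nearLocus_localize_iff T N x q).mp hf)))

/-- **(Dich⁺) transfers UP, with nontriviality, the non-closed generic point and regularity bundled** — the dominant branch as
«irreducible ∧ nontrivial ∧ (some non-closed point) ∧ regular», the finite branch as «finite ∧ all points closed» (for `x` CLOSED).
[cite: CossartJannsenSaito2020, p. 94, p. 107] -/
theorem dichPlus_of_localize (hx : IsClosed ({x} : Set (T.X 0))) (hN : IsClosed (T.nearLocus N x q))
    (h : haveI : IsLocallyNoetherian (T.X 0) := T.ln 0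
      haveI := flat_fromSpecStalk (T.X 0) x
      (IsIrreducible ((T.localize x).nearLocus N (closedPoint ((T.X 0).presheaf.stalk x)) q) ∧
          ((T.localize x).nearLocus N (closedPoint ((T.X 0).presheaf.stalk x)) q).Nontrivial ∧
          (∃ s ∈ (T.localize x).nearLocus N (closedPoint ((T.X 0).presheaf.stalk x)) q,
            ¬ IsClosed ({s} : Set ((T.localize x).X q))) ∧
          ∀ hS : IsClosed ((T.localize x).nearLocus N (closedPoint ((T.X 0).presheaf.stalk x)) q),
            Scheme.IsRegular (vanishingIdeal (⟨(T.localize x).nearLocus N (closedPoint ((T.X 0).presheaf.stalk x)) q, hS⟩ :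
              Closeds ((T.localize x).X q))).subscheme) ∨
        (((T.localize x).nearLocus N (closedPoint ((T.X 0).presheaf.stalk x)) q).Finite ∧
          ∀ s ∈ (T.localize x).nearLocus N (closedPoint ((T.X 0).presheaf.stalk x)) q,
            IsClosed ({s} : Set ((T.localize x).X q)))) :
    (IsIrreducible (T.nearLocus N x q) ∧ (T.nearLocus N x q).Nontrivial ∧
        (∃ z ∈ T.nearLocus N x q, ¬ IsClosed ({z} : Set (T.X q))) ∧
        Scheme.IsRegular (vanishingIdeal (⟨T.nearLocus N x q, hN⟩ : Closeds (T.X q))).subscheme) ∨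
      ((T.nearLocus N x q).Finite ∧ ∀ z ∈ T.nearLocus N x q, IsClosed ({z} : Set (T.X q))) := by
  haveI : IsLocallyNoetherian (T.X 0) := T.ln 0
  haveI := flat_fromSpecStalk (T.X 0) x
  have hx' : IsClosed ({((T.X 0).fromSpecStalk x).base (closedPoint ((T.X 0).presheaf.stalk x))} : Set (T.X 0)) := by
    rw [Scheme.fromSpecStalk_closedPoint]; exact hx
  have hS : IsClosed ((T.localize x).nearLocus N (closedPoint ((T.X 0).presheaf.stalk x)) q) := by
    rw [T.nearLocus_localize x N q]
    exact hN.preimage (T.bcι ((T.X 0).fromSpecStalk x) q).continuous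
  rcases h with ⟨hirr, hnt, hgen, hreg⟩ | ⟨hfin, hcl⟩
  · refine Or.inl ⟨isIrreducible_nearLocus_of_localize T N x q hirr, ?_, ?_, isRegular_nearLocus_of_localize T N x q hS hN (hreg hS)⟩
    · have h1 := (nontrivial_nearLocus_baseChange_iff T ((T.X 0).fromSpecStalk x) N (closedPoint ((T.X 0).presheaf.stalk x)) q).mp hnt
      rwa [Scheme.fromSpecStalk_closedPoint] at h1
    · have h1 := exists_not_isClosed_singleton_nearLocus_of_baseChange T ((T.X 0).fromSpecStalk x) N
        (closedPoint ((T.X 0).presheaf.stalk x)) q hgen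
      rwa [Scheme.fromSpecStalk_closedPoint] at h1
  · refine Or.inr ⟨(finite_nearLocus_localize_iff T N x q).mp hfin, ?_⟩
    have h1 := forall_isClosed_singleton_nearLocus_of_baseChange T ((T.X 0).fromSpecStalk x) N
      (closedPoint ((T.X 0).presheaf.stalk x)) q hx' hcl
    rwa [Scheme.fromSpecStalk_closedPoint] at h1

end Localize

/-! ## Appended (gen 4): the standing hypotheses of the one-step theorems transfer DOWN to the base-changed / localised tower -/

section Hypotheses

variable (T : BlowupTower.{u}) {S₀ : Scheme.{u}} (ι₀ : S₀ ⟶ T.X 0) [Flat ι₀] [IsPreimmersion ι₀] [IsLocallyNoetherian S₀] (N : ℕ)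

/-- **Closed Hilbert–Samuel strata transfer to the base-changed tower** (`H_{S_n}(s) = H_{X_n}(ι_n s)`: the strata of `S_n` are the
preimages of those of `X_n`) — the hypothesis `hcl` of the one-step theorems for `T.baseChange ι₀` / `T.localize x`.
[cite: CossartJannsenSaito2020, Lemma 2.27 (1), p. 107] -/
theorem isClosed_hsStratumGE_baseChange (hcl : ∀ (j : ℕ) (μ : ℕ → ℕ), IsClosed (Scheme.hsStratumGE (T.X j) N μ)) :
    ∀ (j : ℕ) (μ : ℕ → ℕ), IsClosed (Scheme.hsStratumGE ((T.baseChange ι₀).X j) N μ) := by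
  intro j μ
  have heq : Scheme.hsStratumGE ((T.baseChange ι₀).X j) N μ = (T.bcι ι₀ j).base ⁻¹' Scheme.hsStratumGE (T.X j) N μ := by
    ext s
    rw [Scheme.mem_hsStratumGE_iff, Set.mem_preimage, Scheme.mem_hsStratumGE_iff, T.hsFun_baseChange ι₀ N j s]
  rw [heq]
  exact (hcl j μ).preimage (T.bcι ι₀ j).continuous

/-- **Closed strata on the localised tower `T.localize x`.** [cite: CossartJannsenSaito2020, p. 107] -/
theorem isClosed_hsStratumGE_localize (x : T.X 0) (hcl : ∀ (j : ℕ) (μ : ℕ → ℕ), IsClosed (Scheme.hsStratumGE (T.X j) N μ)) :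
    haveI : IsLocallyNoetherian (T.X 0) := T.ln 0
    haveI := flat_fromSpecStalk (T.X 0) x
    ∀ (j : ℕ) (μ : ℕ → ℕ), IsClosed (Scheme.hsStratumGE ((T.localize x).X j) N μ) := by
  haveI : IsLocallyNoetherian (T.X 0) := T.ln 0
  haveI := flat_fromSpecStalk (T.X 0) x
  exact isClosed_hsStratumGE_baseChange T ((T.X 0).fromSpecStalk x) N hcl

/-- **The localised tower starts on a NOETHERIAN scheme** (`Spec 𝒪_{X_0,x}`) — the hypothesis `IsNoetherian (T.X 0)` of the finiteness
statements, for `T.localize x`. [folklore] -/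
theorem isNoetherian_localize_zero (x : T.X 0) : IsNoetherian ((T.localize x).X 0) := by
  haveI : IsLocallyNoetherian (T.X 0) := T.ln 0
  show IsNoetherian (Spec ((T.X 0).presheaf.stalk x))
  infer_instance

end Hypotheses

end BlowupTowerNear

end Summit.ResolutionOfSingularities.ResolutionOfSingularities.Theorems.SigmaMaxModificationsCorridor3.Helpers

end
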